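import Summits.AtomisticToContinuum.FouriersLaw.Theorems.BondHeatUncertaintyBoundedResponseBathHeatKickProfileC
import HarnessLib

/-!
# BondHeatUncertainty / BoundedResponse — «KickProfile» §5: PHONON CALIBRATION of the response curves (`lam = β = 0`)
(decomp-a2c lens-1, g110, NODE 110 «KickProfile / EnergyResponse»; part 4 of 4 = main — overview in part 1 `…KickProfileA`, rungs in part 3 `…KickProfileC`)

★ `kickProfiles_harmonic`: in the harmonic chain, for every `N ≥ 1`, real `t`, `T > 0` there are `c ≥ 0, e, v` with `V̄_{N,t} ≡ v` (FLAT temperature response),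
`M̄_{N,t}(k) = c k² + e`, `Ḡ_{N,t}(k) = c k² + e + v` (even convex parabolas; `m_t` affine with `m_t(0) = 0` by flip symmetry);
★ `kickResponse_harmonic`: hence `Ḡ`, `M̄` convex and energy-monotone, `V̄` flat, and all three crossing defects vanish — every hung hypothesis of §4 holds
there with `A = 0` (the calibration every earlier node of this lineage demanded of its rungs).  No `sorry`, no new axioms.
-/

noncomputable section

open MeasureTheory ProbabilityTheory Filter Topology Set Function
open scoped NNReal ENNReal
open Literature.MathematicalPhysics.KineticTheory.HeatConduction
open Literature.MathematicalPhysics.KineticTheory OscillatorChain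
open Literature.Probability.Process
open Summit.AtomisticToContinuum.FouriersLaw.Theorems.IncoherentChannel.Negative.KernelMoments
  (harmonic_kernel_momentum harmonic_kernel_momentum_sq)
open Summit.AtomisticToContinuum.FouriersLaw.Theorems.IncoherentChannel.Negative.HarmonicFlow
  (harmonic_chainFlow_zero_noise_linear integral_gibbsMeasure_comp_neg integral_gibbsMeasure_eq_zero_of_odd)
open Summit.AtomisticToContinuum.FouriersLaw.Theorems.IncoherentChannel.Negative.GibbsStein
  (integrable_gibbsMeasure_of_growth pow_le_one_add_sq_sq)

namespace Summit.AtomisticToContinuum.FouriersLaw.Theorems.BoundedResponse.HeatSpreading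

/-! ## §5 PHONON CALIBRATION (`lam = β = 0`): the three response curves in closed form — `V̄` constant, `M̄`, `Ḡ` even convex parabolas; all defects `0` -/

/-- A quadratic with nonnegative leading coefficient is convex on `ℝ`. [folklore] -/
theorem convexOn_quadratic {A B C : ℝ} (hA : 0 ≤ A) : ConvexOn ℝ Set.univ (fun k : ℝ => A * k ^ 2 + B * k + C) := by
  refine ⟨convex_univ, fun x _ y _ a b ha hb hab => ?_⟩
  simp only [smul_eq_mul]
  have hb' : b = 1 - a := by linarith
  subst hb'
  nlinarith [mul_nonneg (mul_nonneg ha hb) (mul_nonneg hA (sq_nonneg (x - y)))]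

/-- `θ_T × (even parabola) ∈ L¹(ν_T)`. [folklore] -/
theorem gaussT_integrable_sqSub_mul_quadratic (T c e : ℝ) :
    Integrable (fun k : ℝ => (k ^ 2 - T) * (c * k ^ 2 + e)) (gaussianReal 0 T.toNNReal) := by
  have h : (fun k : ℝ => (k ^ 2 - T) * (c * k ^ 2 + e)) = fun k => c * k ^ 4 + (e - T * c) * k ^ 2 + (-(T * e)) * k ^ 0 := by
    funext k; ring
  rw [h]
  -- landing lane (hand-2 g40): part A's `gaussT_integrable_pow` is private (dedup token); cite the TREE lemma it restates.
  exact (((Summit.AtomisticToContinuum.FouriersLaw.Theorems.PhononMeanFreePath.lightCone_integrable_pow_gaussianReal T 4).const_mul c).add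
    ((Summit.AtomisticToContinuum.FouriersLaw.Theorems.PhononMeanFreePath.lightCone_integrable_pow_gaussianReal T 2).const_mul _)).add
    ((Summit.AtomisticToContinuum.FouriersLaw.Theorems.PhononMeanFreePath.lightCone_integrable_pow_gaussianReal T 0).const_mul _)

section Harmonic

variable {ω₂ γ : ℝ} (hω : 0 < ω₂) (hγ : 0 ≤ γ) {T : ℝ} (hT : 0 < T)
include hω hγ hT

/-- ★ **PHONON CALIBRATION OF THE RESPONSE CURVES** (`lam = β = 0`, every `N = n+1 ≥ 1`, every real `t`, every `T > 0`): there are `c ≥ 0`, `e`, `v` (depending on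
`N, t, T`) with, for EVERY kick `k`,
  `V̄_{N,t}(k) = v` (the temperature response is FLAT: the conditional variance of a linear SDE does not see the initial state),
  `M̄_{N,t}(k) = c·k² + e` and `Ḡ_{N,t}(k) = c·k² + e + v` (even convex PARABOLAS: `m_t` is affine in `z` with `m_t(0) = 0` by flip symmetry, `c = (∂_{p₀} m_t)²`).
Hence in the harmonic chain every rung of §4 holds with room: kick-convex, energy-monotone, all three crossing defects `0`. [this cell; harmonic Gibbs/OU structure:
RiederLebowitzLieb1967-type folklore] -/
theorem kickProfiles_harmonic (n : ℕ) (t : ℝ) :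
    ∃ c e v : ℝ, 0 ≤ c ∧ ∀ k : ℝ,
      varKickProfile ω₂ 0 0 γ T (n + 1) t k = v ∧
        sqFcastKickProfile ω₂ 0 0 γ T (n + 1) t k = c * k ^ 2 + e ∧
        kinKickProfile ω₂ 0 0 γ T (n + 1) t k = c * k ^ 2 + e + v := by
  have hn : 0 < n + 1 := Nat.succ_pos n
  set P := pinnedChain ω₂ 0 0 γ with hP
  set τ : ℝ≥0 := t.toNNReal with hτ
  set μ := P.gibbsMeasure (n + 1) T with hμ
  haveI : IsProbabilityMeasure μ := pinnedChain_isProbabilityMeasure_gibbsMeasure hω le_rfl le_rfl γ (n + 1) hT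
  -- the deterministic flow is linear; gL = p₀ ∘ M_τ
  obtain ⟨M, hM⟩ := harmonic_chainFlow_zero_noise_linear hω hγ (n + 1) (τ : ℝ)
  set gL : PhaseSpace (n + 1) →L[ℝ] ℝ :=
    LinearMap.toContinuousLinearMap (((LinearMap.proj (0 : Fin (n + 1))).comp (LinearMap.snd ℝ _ _)).comp M) with hgL
  have hg : ∀ x, gL x = (M x).2 0 := fun x => rfl
  set G := ‖gL‖ with hG
  have hgb : ∀ x, |gL x| ≤ G * ‖x‖ := fun x => by
    have := gL.le_opNorm x; rwa [Real.norm_eq_abs] at this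
  -- kernel moments at rest; the rest-started momentum forecast VANISHES by flip symmetry
  set m : ℝ := ∫ y, y.2 (0 : Fin (n + 1)) ∂(P.transitionKernel (n + 1) T T τ 0) with hm
  set w : ℝ := ∫ y, y.2 (0 : Fin (n + 1)) ^ 2 ∂(P.transitionKernel (n + 1) T T τ 0) with hw
  have hm0 : m = 0 := by
    have h := momFcast_neg hω le_rfl le_rfl hγ T n τ (0 : PhaseSpace (n + 1))
    rw [neg_zero] at h
    rw [hm, hP]
    linarith
  have hK1 : ∀ z : PhaseSpace (n + 1), ∫ y, y.2 0 ∂(P.transitionKernel (n + 1) T T τ z) = gL z := by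
    intro z
    rw [harmonic_kernel_momentum hω hγ hn hT τ z 0, hM z, hg, ← hm, hm0, add_zero]
  have hK2 : ∀ z : PhaseSpace (n + 1), ∫ y, y.2 0 ^ 2 ∂(P.transitionKernel (n + 1) T T τ z) = gL z ^ 2 + w := by
    intro z
    rw [harmonic_kernel_momentum_sq hω hγ hn hT τ z 0, hM z, hg, ← hm, hm0]
    ring
  -- the kick is a translation along e = (0, δ₀) in phase space; gL is linear along it
  set e₀ : PhaseSpace (n + 1) := ((0 : Fin (n + 1) → ℝ), (Pi.single 0 1 : Fin (n + 1) → ℝ)) with he₀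
  have hvec : ∀ (z : PhaseSpace (n + 1)) (k : ℝ),
      ((z.1, Function.update z.2 0 k) : PhaseSpace (n + 1)) = (z.1, Function.update z.2 0 0) + k • e₀ := by
    intro z k
    refine Prod.ext (by simp [he₀]) ?_
    funext j
    by_cases hj : j = 0
    · subst hj; simp [he₀]
    · simp [he₀, Function.update_of_ne hj, Pi.single_eq_of_ne hj]
  set a : ℝ := gL e₀ with ha
  set b : PhaseSpace (n + 1) → ℝ := fun z => gL (z.1, Function.update z.2 0 0) with hb
  have hshift : ∀ (z : PhaseSpace (n + 1)) (k : ℝ), gL (z.1, Function.update z.2 0 k) = b z + k * a := by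
    intro z k
    rw [hvec z k, map_add, map_smul, smul_eq_mul]
  have hb_eq : ∀ z : PhaseSpace (n + 1), b z = gL z - z.2 0 * a := by
    intro z
    have h := hshift z (z.2 0)
    simp only [Function.update_eq_self, Prod.mk.eta] at h
    linarith
  -- integrability of b, b² under μ (growth bounds, as in the harmonic corner of NODE 108)
  have hgc : Continuous fun x : PhaseSpace (n + 1) => gL x := gL.continuous
  have hpc : Continuous fun x : PhaseSpace (n + 1) => x.2 (0 : Fin (n + 1)) := by fun_prop
  have hI_p : Integrable (fun x : PhaseSpace (n + 1) => x.2 0) μ := by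
    refine integrable_gibbsMeasure_of_growth hω le_rfl le_rfl hT hpc (A := 1) fun x => ?_
    have h1 := OscillatorChain.abs_snd_apply_le_norm x 0
    have h2 := (pow_le_one_add_sq_sq (norm_nonneg x)).1
    linarith
  have hI_g : Integrable (fun x : PhaseSpace (n + 1) => gL x) μ := by
    refine integrable_gibbsMeasure_of_growth hω le_rfl le_rfl hT hgc (A := G) fun x => ?_
    have h2 := (pow_le_one_add_sq_sq (norm_nonneg x)).1
    calc |gL x| ≤ G * ‖x‖ := hgb x
      _ ≤ G * (1 + ‖x‖ ^ 2) ^ 2 := by nlinarith [norm_nonneg gL]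
  have hI_pg : Integrable (fun x : PhaseSpace (n + 1) => x.2 0 * gL x) μ := by
    refine integrable_gibbsMeasure_of_growth hω le_rfl le_rfl hT (hpc.mul hgc) (A := G) fun x => ?_
    have h1 := OscillatorChain.abs_snd_apply_le_norm x 0
    have h4 := (pow_le_one_add_sq_sq (norm_nonneg x)).2.1
    rw [abs_mul]
    calc |x.2 0| * |gL x| ≤ ‖x‖ * (G * ‖x‖) := mul_le_mul h1 (hgb x) (abs_nonneg _) (norm_nonneg _)
      _ = G * ‖x‖ ^ 2 := by ring
      _ ≤ G * (1 + ‖x‖ ^ 2) ^ 2 := by nlinarith [norm_nonneg gL]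
  have hI_pp : Integrable (fun x : PhaseSpace (n + 1) => x.2 0 ^ 2) μ := by
    refine integrable_gibbsMeasure_of_growth hω le_rfl le_rfl hT (hpc.pow 2) (A := 1) fun x => ?_
    have h1 := OscillatorChain.abs_snd_apply_le_norm x 0
    have h4 := (pow_le_one_add_sq_sq (norm_nonneg x)).2.1
    rw [abs_pow]
    calc |x.2 0| ^ 2 ≤ ‖x‖ ^ 2 := pow_le_pow_left₀ (abs_nonneg _) h1 2
      _ ≤ 1 * (1 + ‖x‖ ^ 2) ^ 2 := by linarith
  have hI_gg : Integrable (fun x : PhaseSpace (n + 1) => gL x ^ 2) μ := by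
    refine integrable_gibbsMeasure_of_growth hω le_rfl le_rfl hT (hgc.pow 2) (A := G ^ 2) fun x => ?_
    rw [abs_pow]
    have h4 := (pow_le_one_add_sq_sq (norm_nonneg x)).2.1
    calc |gL x| ^ 2 ≤ (G * ‖x‖) ^ 2 := pow_le_pow_left₀ (abs_nonneg _) (hgb x) 2
      _ = G ^ 2 * ‖x‖ ^ 2 := by ring
      _ ≤ G ^ 2 * (1 + ‖x‖ ^ 2) ^ 2 := by nlinarith [sq_nonneg G]
  have hI_b : Integrable b μ := by
    have h : b = fun z => gL z - z.2 0 * a := funext hb_eq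
    rw [h]
    exact hI_g.sub (hI_p.mul_const a)
  have hI_bb : Integrable (fun z => b z ^ 2) μ := by
    have h : (fun z => b z ^ 2) = fun z => (gL z ^ 2 - (2 * a) * (z.2 0 * gL z)) + a ^ 2 * z.2 0 ^ 2 := by
      funext z; rw [hb_eq z]; ring
    rw [h]
    exact (hI_gg.sub (hI_pg.const_mul _)).add (hI_pp.const_mul _)
  -- b is flip-odd, hence has Gibbs mean zero
  have hb0 : ∫ z, b z ∂μ = 0 := by
    refine integral_gibbsMeasure_eq_zero_of_odd (n + 1) T (g := b) fun z => ?_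
    simp only [hb, Prod.fst_neg, Prod.snd_neg]
    rw [show ((-z.1, Function.update (-z.2) 0 0) : PhaseSpace (n + 1)) = -((z.1, Function.update z.2 0 0) : PhaseSpace (n + 1)) by
      rw [update_zero_neg, neg_zero, Prod.neg_mk], map_neg]
  set eM : ℝ := ∫ z, b z ^ 2 ∂μ with heM
  refine ⟨a ^ 2, eM, w, sq_nonneg a, fun k => ?_⟩
  -- the coherent curve: ∫ (b + k a)² dμ = a² k² + eM
  have hMbar : sqFcastKickProfile ω₂ 0 0 γ T (n + 1) t k = a ^ 2 * k ^ 2 + eM := by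
    rw [sqFcastKickProfile_succ]
    unfold kickAvg
    rw [← hP, ← hτ, ← hμ]
    simp_rw [hK1, hshift]
    have hexp : (fun z : PhaseSpace (n + 1) => (b z + k * a) ^ 2) = fun z => (b z ^ 2 + (2 * k * a) * b z) + (k * a) ^ 2 := by
      funext z; ring
    have hI1 : Integrable (fun z : PhaseSpace (n + 1) => b z ^ 2 + (2 * k * a) * b z) μ := hI_bb.add (hI_b.const_mul (2 * k * a))
    rw [hexp, integral_add hI1 (integrable_const _), integral_add hI_bb (hI_b.const_mul _),
      integral_const_mul, hb0, integral_const, probReal_univ]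
    simp only [mul_zero, add_zero, smul_eq_mul, one_mul]
    ring
  have hVbar : varKickProfile ω₂ 0 0 γ T (n + 1) t k = w := by
    rw [varKickProfile_succ]
    unfold kickAvg
    rw [← hP, ← hτ, ← hμ]
    simp_rw [hK1, hK2]
    have h : (fun z : PhaseSpace (n + 1) => gL (z.1, Function.update z.2 0 k) ^ 2 + w - gL (z.1, Function.update z.2 0 k) ^ 2) =
        fun _ => w := by
      funext z; ring
    rw [h, integral_const, probReal_univ, one_smul]
  have hGbar : kinKickProfile ω₂ 0 0 γ T (n + 1) t k = a ^ 2 * k ^ 2 + eM + w := by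
    rw [kinKickProfile_succ]
    unfold kickAvg
    rw [← hP, ← hτ, ← hμ]
    simp_rw [hK2, hshift]
    have hexp : (fun z : PhaseSpace (n + 1) => (b z + k * a) ^ 2 + w) = fun z => ((b z ^ 2 + (2 * k * a) * b z) + ((k * a) ^ 2 + w)) := by
      funext z; ring
    have hI1 : Integrable (fun z : PhaseSpace (n + 1) => b z ^ 2 + (2 * k * a) * b z) μ := hI_bb.add (hI_b.const_mul (2 * k * a))
    rw [hexp, integral_add hI1 (integrable_const _), integral_add hI_bb (hI_b.const_mul _),
      integral_const_mul, hb0, integral_const, probReal_univ]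
    simp only [mul_zero, add_zero, smul_eq_mul, one_mul]
    ring
  exact ⟨hVbar, hMbar, hGbar⟩

/-- ★ **PHONON RUNGS**: in the harmonic chain, for every `N ≥ 1` and every real `t`, the energy and coherent response curves are CONVEX and NONDECREASING IN THE
ENERGY, the temperature response curve is FLAT, and all three crossing defects VANISH — every hung hypothesis of §4 holds there with `A = 0`. [this cell] -/
theorem kickResponse_harmonic (n : ℕ) (t : ℝ) :
    ConvexOn ℝ Set.univ (kinKickProfile ω₂ 0 0 γ T (n + 1) t) ∧
      ConvexOn ℝ Set.univ (sqFcastKickProfile ω₂ 0 0 γ T (n + 1) t) ∧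
      (∀ k₁ k₂ : ℝ, k₁ ^ 2 ≤ k₂ ^ 2 → kinKickProfile ω₂ 0 0 γ T (n + 1) t k₁ ≤ kinKickProfile ω₂ 0 0 γ T (n + 1) t k₂) ∧
      (∀ k₁ k₂ : ℝ, varKickProfile ω₂ 0 0 γ T (n + 1) t k₁ = varKickProfile ω₂ 0 0 γ T (n + 1) t k₂) ∧
      kinResponseDefect ω₂ 0 0 γ T (n + 1) t = 0 ∧ varResponseDefect ω₂ 0 0 γ T (n + 1) t = 0 ∧
      sqFcastResponseDefect ω₂ 0 0 γ T (n + 1) t = 0 := by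
  obtain ⟨c, e, v, hc, h⟩ := kickProfiles_harmonic hω hγ hT n t
  have hG : kinKickProfile ω₂ 0 0 γ T (n + 1) t = fun k => c * k ^ 2 + 0 * k + (e + v) := by
    funext k; rw [(h k).2.2]; ring
  have hMf : sqFcastKickProfile ω₂ 0 0 γ T (n + 1) t = fun k => c * k ^ 2 + 0 * k + e := by
    funext k; rw [(h k).2.1]; ring
  have hVf : varKickProfile ω₂ 0 0 γ T (n + 1) t = fun _ => v := by
    funext k; exact (h k).1
  have hmonoG : ∀ k₁ k₂ : ℝ, k₁ ^ 2 ≤ k₂ ^ 2 → kinKickProfile ω₂ 0 0 γ T (n + 1) t k₁ ≤ kinKickProfile ω₂ 0 0 γ T (n + 1) t k₂ := by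
    intro k₁ k₂ hk
    rw [(h k₁).2.2, (h k₂).2.2]
    nlinarith
  have hmonoM : ∀ k₁ k₂ : ℝ, k₁ ^ 2 ≤ k₂ ^ 2 → sqFcastKickProfile ω₂ 0 0 γ T (n + 1) t k₁ ≤ sqFcastKickProfile ω₂ 0 0 γ T (n + 1) t k₂ := by
    intro k₁ k₂ hk
    rw [(h k₁).2.1, (h k₂).2.1]
    nlinarith
  refine ⟨hG ▸ convexOn_quadratic hc, hMf ▸ convexOn_quadratic hc, hmonoG, fun k₁ k₂ => by rw [(h k₁).1, (h k₂).1], ?_, ?_, ?_⟩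
  · unfold kinResponseDefect
    refine thermalCrossDefect_eq_zero_of_affineCross (affineCross_of_monotoneSq hT.le hmonoG) ?_
    rw [hG]
    exact (gaussT_integrable_sqSub_mul_quadratic T c (e + v)).congr (ae_of_all _ fun k => by ring)
  · unfold varResponseDefect
    refine thermalCrossDefect_eq_zero_of_affineCross (a := v) (b := 0) (fun k => by rw [hVf]; simp) ?_
    rw [hVf]
    simpa using gaussT_integrable_sqSub_mul_affine T v 0
  · unfold sqFcastResponseDefect
    refine thermalCrossDefect_eq_zero_of_affineCross (affineCross_of_monotoneSq hT.le hmonoM) ?_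
    rw [hMf]
    exact (gaussT_integrable_sqSub_mul_quadratic T c e).congr (ae_of_all _ fun k => by ring)

end Harmonic

end Summit.AtomisticToContinuum.FouriersLaw.Theorems.BoundedResponse.HeatSpreading

end
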